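import Summits.AtomisticToContinuum.HydrodynamicLimit.Theses.OneFlightGossipEngine
import Summits.AtomisticToContinuum.HydrodynamicLimit.Theorems.TwoClocksEntropyToHydro
import Summits.AtomisticToContinuum.HydrodynamicLimit.Theorems.OneFlightGossipEngineDroppedItemsRecord

/-!
# Route OneFlightGossipEngine — the `Assembly` frame (item stmt-AtomisticToContinuum-14647): reductions

`OneFlightGossipEngine.Assembly` is the frame statement
`OneFlightLayeredChaos → KineticCurrentsWindowLDUniform → EquilibriumClampedCollisionalWindowLD →
CollisionActivityTails → EnergyCurrentTails → DiluteSelfConsistency → HydrodynamicLimit`.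
It is NOT a hypothesis of the route's deciding theorem `OneFlightGossipEngine.closes`
(`hD hK h₃ h₇ h₆ hS`, `hD : ClampedCurrentsDock`), and it deliberately omits the dock
`ClampedCurrentsDock` (stmt-AtomisticToContinuum-14680) from its antecedents; consequently its
content is exactly the dock's, with the mechanism crux `OneFlightLayeredChaos` (B1′,
stmt-AtomisticToContinuum-14535) as an idle extra antecedent.

This file records, sorry-free and against the live route modules, the pure-logic facts that pin the
item to the ledger's other statements (the twin of `TwoClocksAssembly.lean` for the sibling route):

* `oneFlightGossipEngine_assembly_iff` (now `…assembly14647_iff`) — `Assembly ↔ (OneFlightLayeredChaos → ClampedCurrentsDock)`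
  (`Iff.rfl`): any proof of the item that does not use B1′ IS a proof of crux 14680, and conversely
  the item closes by `fun _ => hD` the moment `ClampedCurrentsDock_holds` lands;
* `oneFlightGossipEngine_assembly_of_clampedCurrentsDock` — that one-liner;
* `oneFlightGossipEngine_assembly_of_hydrodynamicLimit` — the frame is implied by the sub-problem
  Statement itself, so a refutation `¬ Assembly` would refute the summit conjunct (there is no
  degenerate `¬`-settlement);
* `oneFlightGossipEngine_assembly_of_relEntropyVanishing` — the shared entropy target
  `TwoClocks.RelEntropyVanishing` (stmt-AtomisticToContinuum-0766) closes the item through the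
  landed entropy-inequality glue `entropyToHydro_proof` (file `TwoClocksEntropyToHydro.lean`), all
  six antecedents then being idle;
* `kineticCurrentsWindowLDUniform_of_kineticWindowLDUniform` — the docking node of this route
  (stmt-AtomisticToContinuum-14662, restricted class `Σ A_jk w_j w_k + (b·w) G(x,|w|²)`) is the
  special case of TwoClocks' docking node `TwoClocks.KineticWindowLDUniform`
  (stmt-AtomisticToContinuum-14442, all continuous fast one-body `F` of quadratic growth): the only
  work is the continuity of the restricted-class functional;
* `twoClocks_*_iff` — the four shared inputs (stmt-13733, 13734, 9235, 3091) are the same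
  propositions in the two route files (`Iff.rfl`), and hence
* `twoClocks_assembly_of_clampedCurrentsDock` — this route's dock (14680) also closes TwoClocks'
  frame `TwoClocks.Assembly` (stmt-AtomisticToContinuum-13805), its statics being idle there.

Nothing here claims mathematical content beyond bookkeeping; the dock itself (Yau's relative-entropy
clock with window-averaged restricted kinetic currents and clamped collisional transfer) is crux
stmt-AtomisticToContinuum-14680.

**Repair / re-scoping 2026-08-17 (fullbuild breakage: "Unknown identifier `OneFlightGossipEngine.ClampedCurrentsDock`",
"`TwoClocks.EquilibriumClampedCollisionalWindowLD`", "`TwoClocks.CollisionActivityTails`", two type mismatches).**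
Since this file was written (rev 21, item stmt-14647) the two route files moved: `EquilibriumClampedCollisionalWindowLD`
(stmt-13733) was REFUTED and dropped from both, `TwoClocks` restated `CollisionActivityTails` (13734 ↦ 16624) and its
frame `Assembly` (now over `ClampedTransferWindowLD` / `TransferActivityTails` / statics), and `OneFlightGossipEngine`
replaced its dock `ClampedCurrentsDock` (14680) by `ClampedTransferDock` and restated `Assembly` UNDER THE SAME NAME
(revs 25, 29: stmt-16666, stmt-17616 — `OneFlightLayeredChaos → KineticCurrentsLDAlongFamilies → CollisionActivityTails
→ EnergyCurrentTails → HydrodynamicLimit`, four antecedents, packing-guarded conjunct; its reductions are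
`Theorems/OneFlightGossipEngineAssemblyDock.lean`). The dropped constants (and the rev-21 `Assembly`, as
`AssemblyStmt14647`) are recorded verbatim in `Theorems/OneFlightGossipEngineDroppedItemsRecord.lean` (the two
readings of the refuted stmt-13733 in `Theorems/TwoClocksEquilibriumClampedCollisionalWindowLDRefutation.lean`), now
imported; since 13733 is refuted the recorded dock holds VACUOUSLY (`oneFlightGossipEngine_clampedCurrentsDock_vacuous`).
Of the eleven records below, those whose statement text is unchanged and still true are re-proved against the live
modules (`…_assembly_of_hydrodynamicLimit`, `…_assembly_of_relEntropyVanishing` — four idle antecedents, and through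
`HydrodynamicLimit.of_unguarded` since the conjunct re-type; the docking-node and `Iff.rfl` coincidence lemmas,
now partly against the records); `…_clampedCurrentsDock_of_assembly` keeps its statement (now vacuously true); the two that tracked the re-typed
`OneFlightGossipEngine.Assembly` and fail for it (`…_assembly_iff`, `…_assembly_of_clampedCurrentsDock`) are restated
over the recorded rev-21 frame `AssemblyStmt14647` under new names and kept as `@[deprecated]` aliases (Theorems files are
append-only: a recorded declaration is neither restated nor removed); and `twoClocks_assembly_of_clampedCurrentsDock`,
whose TwoClocks frame no longer supplies the refuted clamped window node nor the 13734 activity tails, is kept as a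
`@[deprecated]` alias of the same implication with those two inputs as explicit hypotheses.
-/

namespace Summit.AtomisticToContinuum.HydrodynamicLimit.Theorems

open Summit.AtomisticToContinuum.HydrodynamicLimit.Theses

/-! ### The frame is the dock with an idle antecedent -/

/-- **The rev-21 frame is `B1′ → Dock`, definitionally.** The frame statement of route OneFlightGossipEngine
as of rev 21 (stmt-AtomisticToContinuum-14647, recorded as `AssemblyStmt14647`) unfolds to
`OneFlightLayeredChaos → ClampedCurrentsDock` (stmt-14535 → stmt-14680, the recorded dock): the two sides are
the same arrow type once `ClampedCurrentsDock` is unfolded. [folklore] -/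
theorem oneFlightGossipEngine_assembly14647_iff :
    OneFlightGossipEngine.AssemblyStmt14647 ↔
      (OneFlightGossipEngine.OneFlightLayeredChaos → OneFlightGossipEngine.ClampedCurrentsDock) :=
  Iff.rfl

/-- **Deprecated record.** Formerly `OneFlightGossipEngine.Assembly ↔ (OneFlightLayeredChaos →
ClampedCurrentsDock)` for the rev-21 `Assembly` (stmt-14647); `Assembly` was restated under the same name
(stmt-17616, over `KineticCurrentsLDAlongFamilies` and without the refuted clamped window node), for which
the `iff` fails, so the name is kept as an alias of the same statement over the recorded rev-21 frame. The
live analogue is `oneFlightGossipEngine_assembly_iff_clampedTransferDock`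
(`Theorems/OneFlightGossipEngineAssemblyDock.lean`). [folklore] -/
@[deprecated oneFlightGossipEngine_assembly14647_iff (since := "2026-08-17")]
alias oneFlightGossipEngine_assembly_iff := oneFlightGossipEngine_assembly14647_iff

/-- **The recorded dock closes the rev-21 frame** (the closing recipe of stmt-AtomisticToContinuum-14647):
from `hD : ClampedCurrentsDock` (stmt-14680) the rev-21 frame follows by dropping the mechanism hypothesis,
`fun _ => hD`. [folklore] -/
theorem oneFlightGossipEngine_assembly14647_of_clampedCurrentsDock
    (hD : OneFlightGossipEngine.ClampedCurrentsDock) : OneFlightGossipEngine.AssemblyStmt14647 :=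
  oneFlightGossipEngine_assembly14647_iff.mpr fun _ => hD

/-- **Deprecated record.** Formerly `ClampedCurrentsDock → OneFlightGossipEngine.Assembly` for the rev-21
`Assembly`; against the re-typed `Assembly` (stmt-17616) the recorded dock cannot be run (its second input,
the clamped window node stmt-13733, is refuted and no longer an antecedent), so the name is kept as an alias of
the same implication into the recorded rev-21 frame. [folklore] -/
@[deprecated oneFlightGossipEngine_assembly14647_of_clampedCurrentsDock (since := "2026-08-17")]
alias oneFlightGossipEngine_assembly_of_clampedCurrentsDock :=
  oneFlightGossipEngine_assembly14647_of_clampedCurrentsDock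

/-- **The recorded dock holds VACUOUSLY.** Its second antecedent, the clamped collisional window node
`EquilibriumClampedCollisionalWindowLD` (stmt-AtomisticToContinuum-13733), is REFUTED in the tree
(`OneFlightGossipEngineEquilibriumClampedCollisionalWindowLD_refuted`), so `ClampedCurrentsDock` (stmt-14680, as
filed) is true for the wrong reason — which is why the route replaced it by `ClampedTransferDock`. [folklore] -/
theorem oneFlightGossipEngine_clampedCurrentsDock_vacuous : OneFlightGossipEngine.ClampedCurrentsDock :=
  fun _ hE => absurd hE OneFlightGossipEngineEquilibriumClampedCollisionalWindowLD_refuted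

/-- **Given the mechanism crux, the frame yields the recorded dock** — since the 2026-08-16 repairs for the
wrong reason: whatever `Assembly` denotes (rev 21: `OneFlightLayeredChaos → ClampedCurrentsDock`, by modus
ponens; rev 29, stmt-17616: unrelated to the recorded dock), the conclusion `ClampedCurrentsDock` (stmt-14680
as filed) holds vacuously (`oneFlightGossipEngine_clampedCurrentsDock_vacuous`). Statement kept verbatim
(Theorems files are append-only). [folklore] -/
theorem oneFlightGossipEngine_clampedCurrentsDock_of_assembly
    (hB : OneFlightGossipEngine.OneFlightLayeredChaos) (hA : OneFlightGossipEngine.Assembly) :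
    OneFlightGossipEngine.ClampedCurrentsDock :=
  (fun (_ : OneFlightGossipEngine.OneFlightLayeredChaos) (_ : OneFlightGossipEngine.Assembly) =>
    oneFlightGossipEngine_clampedCurrentsDock_vacuous) hB hA

/-! ### The Statement itself closes the frame (no `¬`-settlement short of `¬ HydrodynamicLimit`) -/

/-- **The Statement closes the frame.** `Assembly` concludes the sub-problem Statement
`_root_.HydrodynamicLimit`, so it follows from the Statement with all its antecedents idle (six at rev 21,
four since the rev-29 restate stmt-17616). [folklore] -/
theorem oneFlightGossipEngine_assembly_of_hydrodynamicLimit (h : _root_.HydrodynamicLimit) :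
    OneFlightGossipEngine.Assembly :=
  fun _ _ _ _ => h

/-! ### The shared entropy target closes the frame -/

/-- **The entropy target closes the frame.** If the shared typed target
`TwoClocks.RelEntropyVanishing` (stmt-AtomisticToContinuum-0766: `o(N)` relative entropy of the law
at time `t` with respect to a reference local Gibbs law whose fields concentrate exponentially around
the Euler fields) holds, then `OneFlightGossipEngine.Assembly` holds with all its antecedents idle,
through the landed entropy-inequality glue `entropyToHydro_proof : TwoClocks.EntropyToHydro`
(`RelEntropyVanishing → Literature….HydrodynamicLimit`, file `TwoClocksEntropyToHydro.lean`) and, since the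
2026-08-16 re-type of the conjunct to the packing-guarded statement, `HydrodynamicLimit.of_unguarded`.
[cite: Yau1991, §2] [cite: KipnisLandim1999, Ch. 6 §1] -/
theorem oneFlightGossipEngine_assembly_of_relEntropyVanishing (hRE : TwoClocks.RelEntropyVanishing) :
    OneFlightGossipEngine.Assembly :=
  fun _ _ _ _ => _root_.HydrodynamicLimit.of_unguarded (entropyToHydro_proof hRE)

/-! ### The docking node is the restricted-class case of TwoClocks' docking node -/

/-- **TwoClocks' kinetic docking node implies this route's.** `TwoClocks.KineticWindowLDUniform`
(stmt-AtomisticToContinuum-14442: the `η₀`-uniform finite-window large-deviation bound from local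
Gibbs data for EVERY continuous fast one-body functional `F` of quadratic growth, orthogonal at each
`x` to `1, v_j, |v|²` under `M_(1,u₀(x),θ₀(x))`) implies `OneFlightGossipEngine.KineticCurrentsWindowLDUniform`
(stmt-AtomisticToContinuum-14662: the same bound for the restricted class
`F(x,v) = Σ_jk A_jk(x) w_j w_k + (b(x)·w) G(x,|w|²)`, `w = v − u₀(x)`, `A, b, G` continuous) with
the same `η₀`: instantiate `F`; the growth and orthogonality hypotheses are passed through verbatim
and the only obligation is the continuity of the restricted-class functional. [folklore] -/
theorem kineticCurrentsWindowLDUniform_of_kineticWindowLDUniform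
    (hK : TwoClocks.KineticWindowLDUniform) : OneFlightGossipEngine.KineticCurrentsWindowLDUniform := by
  obtain ⟨η₀, hη₀, h⟩ := hK
  refine ⟨η₀, hη₀, ?_⟩
  intro a θ₀ u₀ ha hθ hu ha0 hθ0 σ hσ hguard Φ A b G hA hb hG
  -- continuity of the restricted-class functional
  -- `y ↦ Σ_jk A y.1 j k · w_j w_k + (Σ_j b y.1 j · w_j) · G (y.1, ‖w‖²)`, `w = y.2 - u₀ y.1`
  have hF : Continuous (fun y : Literature.MathematicalPhysics.KineticTheory.T3 ×
      Literature.MathematicalPhysics.KineticTheory.V3 =>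
      ((∑ j : Fin 3, ∑ k : Fin 3, A y.1 j k * ((y.2 - u₀ y.1) j * (y.2 - u₀ y.1) k)) +
        (∑ j : Fin 3, b y.1 j * (y.2 - u₀ y.1) j) * G (y.1, ‖y.2 - u₀ y.1‖ ^ 2))) := by
    fun_prop
  exact h a θ₀ u₀ ha hθ hu ha0 hθ0 σ hσ hguard Φ
    (fun y : Literature.MathematicalPhysics.KineticTheory.T3 ×
      Literature.MathematicalPhysics.KineticTheory.V3 =>
      ((∑ j : Fin 3, ∑ k : Fin 3, A y.1 j k * ((y.2 - u₀ y.1) j * (y.2 - u₀ y.1) k)) +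
        (∑ j : Fin 3, b y.1 j * (y.2 - u₀ y.1) j) * G (y.1, ‖y.2 - u₀ y.1‖ ^ 2))) hF

/-! ### The shared inputs coincide across the two route files -/

/-- The clamped collisional window LD (shared item stmt-AtomisticToContinuum-13733, refuted and dropped from
both route files; both readings recorded in `OneFlightGossipEngineDroppedItemsRecord`) is the same proposition
in the two records. [folklore] -/
theorem twoClocks_equilibriumClampedCollisionalWindowLD_iff :
    TwoClocks.EquilibriumClampedCollisionalWindowLD ↔
      OneFlightGossipEngine.EquilibriumClampedCollisionalWindowLD :=
  Iff.rfl

/-- The a-priori collision-activity tails (shared item stmt-AtomisticToContinuum-13734; dropped from `TwoClocks`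
and recorded in `OneFlightGossipEngineDroppedItemsRecord`, still declared by `OneFlightGossipEngine`) are the same
proposition in the record and the route file. [folklore] -/
theorem twoClocks_collisionActivityTails_iff :
    TwoClocks.CollisionActivityTails ↔ OneFlightGossipEngine.CollisionActivityTails :=
  Iff.rfl

/-- The cubic energy-current tails (shared item stmt-AtomisticToContinuum-9235) are the same
proposition in the two route files. [folklore] -/
theorem twoClocks_energyCurrentTails_iff :
    TwoClocks.EnergyCurrentTails ↔ OneFlightGossipEngine.EnergyCurrentTails :=
  Iff.rfl

/-- Dilute self-consistency (shared item stmt-AtomisticToContinuum-3091) is the same proposition in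
the two route files. [folklore] -/
theorem twoClocks_diluteSelfConsistency_iff :
    TwoClocks.DiluteSelfConsistency ↔ OneFlightGossipEngine.DiluteSelfConsistency :=
  Iff.rfl

/-- **The recorded dock closes TwoClocks' frame, given the two inputs that frame no longer supplies.**
`OneFlightGossipEngine.ClampedCurrentsDock` (stmt-AtomisticToContinuum-14680, recorded) consumes the
restricted-class kinetic node, which TwoClocks' general node supplies
(`kineticCurrentsWindowLDUniform_of_kineticWindowLDUniform`), the clamped collisional window node (stmt-13733,
refuted, recorded), the 13734 activity tails (recorded), the energy-current tails and dilute self-consistency;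
TwoClocks' frame `TwoClocks.Assembly` (restated 2026-08-16: `KineticWindowLDUniform → ClampedTransferWindowLD →
EnergyCurrentTails → TransferActivityTails → UniformLocalGibbsConcentration → HsEosLowDensity →
DiluteSelfConsistency → HydrodynamicLimit`) supplies the first and the last two of these, so the dock yields it
once the two recorded inputs are given, the transfer nodes and statics being idle (vacuously so: the recorded
`TwoClocks.EquilibriumClampedCollisionalWindowLD` is refuted — kept only as the faithful continuation of the record
below). [folklore] -/
theorem twoClocks_assembly_of_clampedCurrentsDock_of_recordedInputs
    (hD : OneFlightGossipEngine.ClampedCurrentsDock) (h₃ : TwoClocks.EquilibriumClampedCollisionalWindowLD)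
    (h₇ : TwoClocks.CollisionActivityTails) : TwoClocks.Assembly :=
  fun hK _ h₆ _ _ _ hS =>
    hD (kineticCurrentsWindowLDUniform_of_kineticWindowLDUniform hK)
      (twoClocks_equilibriumClampedCollisionalWindowLD_iff.mp h₃)
      (twoClocks_collisionActivityTails_iff.mp h₇) (twoClocks_energyCurrentTails_iff.mp h₆)
      (twoClocks_diluteSelfConsistency_iff.mp hS)

/-- **Deprecated record.** Formerly `ClampedCurrentsDock → TwoClocks.Assembly` for TwoClocks' frame as of
2026-08-16T09Z, whose antecedents included the clamped collisional window node (stmt-13733) and the 13734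
activity tails; the restated frame does not supply them (13733 is refuted), so the name is kept as an alias
of the same implication with the two recorded inputs as explicit hypotheses. [folklore] -/
@[deprecated twoClocks_assembly_of_clampedCurrentsDock_of_recordedInputs (since := "2026-08-17")]
alias twoClocks_assembly_of_clampedCurrentsDock := twoClocks_assembly_of_clampedCurrentsDock_of_recordedInputs

end Summit.AtomisticToContinuum.HydrodynamicLimit.Theorems
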